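import Mathlib
import Summits.ValiantsHypothesis.ValiantsHypothesis.Theorems.FifoMatchingNNDivisionHardLowDimFace
import Summits.ValiantsHypothesis.ValiantsHypothesis.Theorems.FifoMatchingXcDivisionChamberCertificate

/-!
# FifoMatching · XcDivision — PROP D₀: NO DIAGONAL PASSENGER HELPS (`xc(COR(m+1) + Q) ≥ 1.5^m − 1` for `Q ⊆ y₀ + diagonals`)

Theorems-grade port (bytes staged by val-idea-43 g5 for a port hand; AUTHOR of the block: the `xc_division` line, val-idea-38 lineage /
cell val-cor) of §5c of `Cruxes/NNLinearDegreeCofactorHard/Lines/xc_division.lean` (`anMat`, `last_not_mem_map_castSucc`, `anMat_quad`,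
★ `corPolytope_succ_add_diag_three_pow_le`) — statements and proofs VERBATIM over the Theorems-side FMPTW data (`ud_data`, `udInd_*` of
✓ `…NNDivisionHardLowDimFace` / `…LowDimDefs`, `three_pow_le_of_hits` of ✓ `…XcDivisionChamberCertificate`, `flat_dotProduct_vecOuter` /
`flat_dotProduct_le_of_mem_corPolytope` of `Literature/…/BlockPsdLiftFactorization`); namespace `…Theorems.FifoMatching.XcDivision` (same as the
data it consumes).  Consumers: the LINE `Cruxes/NNDivisionHard/Lines/virtual_passenger.lean` §2 `Gadget.patternFreePassengerLaw_holds` and rev 18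
`offDiagConst_blockBlind` cite PROP D₀ through the `xc_division` workfile import; after landing they cite this file BY NAME and the line can
drop `import …Cruxes.NNLinearDegreeCofactorHard.Lines.xc_division` for this use.

The certificate: the ANCHORED clique rows `x_z·Σ_{i∈a} x_i − Σ_{i<j∈a} x_i x_j ≤ 1` (anchor `z`, `a ⊆ [m]`) have no diagonal entries, are valid on
`COR` with slack `(k−1)(k−2)/2`, `k = |a ∩ b|`, on the vertices `b ∋ z` — zero iff `k ∈ {1,2}`: the unique-disjointness pattern, blind to every
diagonal passenger.  HONEST FRAME: a certificate for a class of passengers; stmt-21181 OPEN; VP ≠ VNP NOT proved.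
-/

set_option linter.unusedVariables false
set_option linter.unusedSectionVars false
set_option linter.dupNamespace false

noncomputable section

open Matrix Finset
open scoped Pointwise

namespace Summit.ValiantsHypothesis.ValiantsHypothesis.Theorems.FifoMatching

namespace XcDivision

open Literature.Barriers.PneNP (HasEFOfSize)
open Literature.Combinatorics.Optimization.FixedSizePsdRank (Cube vecOuter bvec corPolytope flat
  flat_dotProduct_vecOuter flat_dotProduct_le_of_mem_corPolytope)

/-! ## §5c PROP D₀: NO diagonal passenger helps — `xc(COR(m+1) + Q) ≥ 1.5^m - 1` for every `Q ⊆ y₀ + diagonals`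
(answers SUB-QUESTION 1 of the price: the diagonal-free projection `conv{(b_i b_j)_{i≠j}}` of `COR(m+1)` has
extension complexity `≥ 1.5^m - 1`).  The certificate is a DIFFERENT row family indexed by COR's combinatorics:
the ANCHORED clique rows `x_z·Σ_{i∈a} x_i - Σ_{i<j∈a} x_i x_j ≤ 1` (anchor `z`, `a ⊆ [m]`), which have no diagonal
entries, are valid on `COR` with slack `(k-1)(k-2)/2`, `k = |a ∩ b|`, on the vertices `b ∋ z` — zero iff
`k ∈ {1, 2}`, one iff `k ∈ {0, 3}`: the unique-disjointness pattern again. -/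

/-- the anchored clique matrix of `a' ⊆ [m]` inside `[m+1]` (anchor `z = last`): quadratic form
`x_z Σ_{i∈A} x_i - ½ (Σ_{i∈A} x_i)² + ½ Σ_{i∈A} x_i²`, `A = castSucc '' a'`; zero diagonal. -/
def anMat {m : ℕ} (a' : Finset (Fin m)) : Matrix (Fin (m + 1)) (Fin (m + 1)) ℝ := fun i j =>
  (if i = Fin.last m then udInd (a'.map Fin.castSuccEmb) j else 0) -
    (1 / 2) * (udInd (a'.map Fin.castSuccEmb) i * udInd (a'.map Fin.castSuccEmb) j -
      (if i = j then udInd (a'.map Fin.castSuccEmb) i else 0))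

/-- the anchor `Fin.last m` is not in the image of `castSucc`. -/
theorem last_not_mem_map_castSucc {m : ℕ} (a' : Finset (Fin m)) :
    Fin.last m ∉ a'.map Fin.castSuccEmb := by
  intro h
  obtain ⟨i, -, hi⟩ := Finset.mem_map.1 h
  exact (Fin.castSucc_lt_last i).ne hi

/-- the anchored quadratic form in closed form -/
theorem anMat_quad {m : ℕ} (a' : Finset (Fin m)) (x : Fin (m + 1) → ℝ) :
    ∑ i, ∑ j, anMat a' i j * (x i * x j) =
      x (Fin.last m) * (∑ j, udInd (a'.map Fin.castSuccEmb) j * x j) -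
        (1 / 2) * ((∑ j, udInd (a'.map Fin.castSuccEmb) j * x j) *
            (∑ j, udInd (a'.map Fin.castSuccEmb) j * x j) -
          ∑ j, udInd (a'.map Fin.castSuccEmb) j * (x j * x j)) := by
  set A := a'.map Fin.castSuccEmb
  have h1 : ∀ i, ∑ j, anMat a' i j * (x i * x j) =
      (if i = Fin.last m then x i * ∑ j, udInd A j * x j else 0) -
        (1 / 2) * (udInd A i * x i * ∑ j, udInd A j * x j - udInd A i * (x i * x i)) := by
    intro i
    have : ∀ j, anMat a' i j * (x i * x j) =
        (if i = Fin.last m then x i * (udInd A j * x j) else 0) -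
          (1 / 2) * (udInd A i * x i * (udInd A j * x j) -
            (if i = j then udInd A i * (x i * x j) else 0)) := by
      intro j
      simp only [anMat]
      split_ifs <;> ring
    simp only [this, Finset.sum_sub_distrib, ← Finset.mul_sum, Finset.sum_ite_eq, Finset.mem_univ,
      if_true]
    split_ifs <;> simp [Finset.mul_sum]
  simp only [h1, Finset.sum_sub_distrib, ← Finset.mul_sum, Finset.sum_ite_eq', Finset.mem_univ, if_true,
    ← Finset.sum_mul]

/-- **PROP D₀ (diagonal passengers cannot help).**  For every `Q ⊆ y₀ + {diagonal matrices}` (any size, any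
shape — boxes, permutahedra, the whole diagonal subspace): `3^m ≤ (r + 1) · 2^m` whenever `COR(m+1) + Q` has an
extended formulation of size `r`. -/
theorem corPolytope_succ_add_diag_three_pow_le {m r : ℕ} {Q : Set (Fin ((m + 1) * (m + 1)) → ℝ)}
    (h : HasEFOfSize (corPolytope (m + 1) + Q) r) {y₀ : Fin ((m + 1) * (m + 1)) → ℝ} (hy₀ : y₀ ∈ Q)
    (hQ : ∀ y ∈ Q, ∃ σ : Fin (m + 1) → ℝ, y = y₀ + flat (Matrix.diagonal σ)) :
    3 ^ m ≤ (r + 1) * 2 ^ m := by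
  classical
  obtain ⟨pt_mem, -, -, diag_pt⟩ := ud_data (m + 1)
  set z : Fin (m + 1) := Fin.last m with hz
  let e : Fin m ↪ Fin (m + 1) := Fin.castSuccEmb
  let B : Finset (Fin m) → Finset (Fin (m + 1)) := fun b' => insert z (b'.map e)
  let A : Finset (Fin m) → Finset (Fin (m + 1)) := fun a' => a'.map e
  have hzA : ∀ a', z ∉ A a' := fun a' => last_not_mem_map_castSucc a'
  have hAB : ∀ a' b', (A a' ∩ B b').card = (a' ∩ b').card := by
    intro a' b'
    have : A a' ∩ B b' = (a' ∩ b').map e := by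
      show a'.map e ∩ insert z (b'.map e) = _
      rw [Finset.inter_insert_of_notMem (hzA a'), Finset.map_inter]
    rw [this, Finset.card_map]
  -- the 0/1 sums at the column points
  have hsum : ∀ a' b', ∑ j, udInd (A a') j * udInd (B b') j = ((a' ∩ b').card : ℝ) := by
    intro a' b'; rw [udInd_inter, hAB]
  have hsq : ∀ (a' : Finset (Fin m)) (b : Finset (Fin (m + 1))),
      ∑ j, udInd (A a') j * (udInd b j * udInd b j) = ∑ j, udInd (A a') j * udInd b j := by
    intro a' b; simp only [udInd_sq]
  have hzB : ∀ b', udInd (B b') z = 1 := by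
    intro b'; rw [udInd_apply, if_pos (Finset.mem_insert_self _ _)]
  -- slack of the anchored row at the column point: `(k-1)(k-2)/2`
  have slack : ∀ a' b', 1 - flat (anMat a') ⬝ᵥ udPt (B b') =
      (((a' ∩ b').card : ℝ) - 1) * (((a' ∩ b').card : ℝ) - 2) / 2 := by
    intro a' b'
    show 1 - flat (anMat a') ⬝ᵥ vecOuter (m + 1) (udInd (B b')) = _
    rw [flat_dotProduct_vecOuter, anMat_quad, hsq, hsum, hzB]
    ring
  -- validity on `COR(m+1)`: for 0/1 points the form is `x_z k - (k² - k)/2 ≤ 1`, `k ∈ ℕ`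
  have valid01 : ∀ (a' : Finset (Fin m)) (x : Fin (m + 1) → ℝ), (∀ i, x i = 0 ∨ x i = 1) →
      ∑ i, ∑ j, anMat a' i j * (x i * x j) ≤ 1 := by
    intro a' x hx
    rw [anMat_quad]
    have hxx : ∀ j, x j * x j = x j := fun j => by rcases hx j with h0 | h0 <;> simp [h0]
    simp only [hxx]
    -- `k := Σ_j 𝟙_A j x_j` is a natural number
    obtain ⟨k, hk⟩ : ∃ k : ℕ, ∑ j, udInd (A a') j * x j = k := by
      refine ⟨(Finset.univ.filter fun j => j ∈ A a' ∧ x j = 1).card, ?_⟩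
      rw [← Finset.sum_boole]
      refine Finset.sum_congr rfl fun j _ => ?_
      rw [udInd_apply]
      rcases hx j with h0 | h0 <;> by_cases hj : j ∈ A a' <;> simp [h0, hj]
    rw [hk]
    have hkk : ((k : ℝ) - 1) * ((k : ℝ) - 2) ≥ 0 := by
      rcases Nat.lt_or_ge k 2 with hk2 | hk2
      · interval_cases k <;> norm_num
      · have : (2 : ℝ) ≤ k := by exact_mod_cast hk2
        nlinarith
    have hk0 : (0 : ℝ) ≤ k := Nat.cast_nonneg k
    rcases hx z with h0 | h0 <;> rw [h0] <;> nlinarith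
  have valid : ∀ a', ∀ y ∈ corPolytope (m + 1), flat (anMat a') ⬝ᵥ y ≤ 1 := fun a' y hy =>
    flat_dotProduct_le_of_mem_corPolytope hy ⟨(anMat a', 1), fun x hx => valid01 a' x hx⟩
  -- the anchored rows are blind to diagonal passengers
  have blind : ∀ a' (σ : Fin (m + 1) → ℝ), flat (anMat a') ⬝ᵥ flat (Matrix.diagonal σ) = 0 := by
    intro a' σ
    rw [flat_dotProduct_flat]
    refine Finset.sum_eq_zero fun i _ => ?_
    have hAz : udInd (a'.map Fin.castSuccEmb) (Fin.last m) = 0 := by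
      rw [udInd_apply, if_neg (last_not_mem_map_castSucc a')]
    have hdiag0 : anMat a' i i = 0 := by
      simp only [anMat, if_true]
      by_cases hi : i = Fin.last m
      · rw [if_pos hi, hi, hAz]; ring
      · rw [if_neg hi, udInd_sq]; ring
    rw [Finset.sum_eq_single i]
    · rw [hdiag0, zero_mul]
    · intro j _ hji; rw [Matrix.diagonal_apply_ne _ (Ne.symm hji), mul_zero]
    · intro hi; exact absurd (Finset.mem_univ i) hi
  have key := three_pow_le_of_hits h (fun b' => udPt (B b')) (fun b' => pt_mem _)
    (fun a' => flat (anMat a')) (fun _ => 1) valid ?_ ?_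
    (fun _ : Unit => y₀) (fun _ => hy₀) (fun a' => ⟨(), fun y hy => ?_⟩)
  · simpa [Fintype.card_fin] using key
  · intro a' b' hlt hone
    have := slack a' b'
    rw [hone] at this
    norm_num at this
    linarith
  · intro a' b' hab
    have := slack a' b'
    rw [Finset.disjoint_iff_inter_eq_empty.1 hab, Finset.card_empty] at this
    norm_num at this
    linarith
  · obtain ⟨σ, rfl⟩ := hQ y hy
    rw [dotProduct_add, blind, add_zero]

end XcDivision

end Summit.ValiantsHypothesis.ValiantsHypothesis.Theorems.FifoMatching

end
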